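import Summits.Ventures.WeilGRH.TwistedWindowSectors
import Summits.RiemannHypothesis.RiemannHypothesis.Theorems.WeilFormatCEntryGram
import Summits.RiemannHypothesis.RiemannHypothesis.Theorems.WeilFormatCCertificate
import HarnessLib

/-!
# GRH arm (rh-explicit, venture WeilGRH): the Gram matrix of an EVEN REAL character on Yoshida's
  windows is Yoshida's matrix with two elementary corrections — entry theorem and certificate interface

Cell `rh-explicit`, WEIL TRACK — GRH ARM (typing seat weil-grh-1).  Sequel of `TwistedWindowSectors.lean`
(`weilTwistIncrement_ofReal`: for a real twist `D^ω = ωD + (1 − ω)²‖·‖²`) and of weil-2's entry theorem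
`weilWindowForm_sum_smul_chi_eq_gramCoeff` (Yoshida 1992 (5.15)/(5.16) = `Yoshida1992.gramCoeff`).

For a Dirichlet character `χ` mod `q` with REAL values (`conj χ(n) = χ(n)`, so `χ(n) ∈ {0, ±1}`) and EVEN
parity (`a_χ = 0`: the same archimedean density as `ζ`), the twisted window form of
`WeilMarkovQuadraticChar.lean` is the `ζ` window form WITHOUT the pole, WITH `(log q)‖u‖₂²`, and with the
prime jumps at the lengths `log k`, `χ(k) ≠ 1`, re-weighted:

  `𝓔^χ_a(u) − M^χ_a‖u‖₂² = [weilWindowForm a u − P(u)] + Σ_{log k<2a} (χ(k) − 1)Λ(k)k^{-1/2}(D_{log k}(u) − 2‖u‖₂²) + (log q)‖u‖₂²`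

for every bounded measurable `u` vanishing off `[-a, a]` (`twistedWindowForm_eq_of_even_real`).  On the
trigonometric windows this is the ENTRY THEOREM (`twistedWindowForm_sum_smul_chi_eq_twistedGramCoeff`):

  `𝓔^χ_a(Σ c_nχ_n) − M^χ_a‖Σ c_nχ_n‖₂² = Σ_n Σ_m Re(conj c_n c_m) · twistedGramCoeff χ a n m`,
  `twistedGramCoeff χ a n m = gramCoeff a n m − polarCoeff a n m`
     `+ Σ_{log k<2a} (χ(k) − 1)Λ(k)k^{-1/2}(incrCoeff a (log k) n m − 2δ_{nm}) + (log q)δ_{nm}`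

in the vocabulary of `Literature/…/YoshidaWindowGram.lean` — so the cell's EXISTING interval evaluators of
`gramCoeff` / `polarCoeff` / `incrCoeff` (format C/E) price an even real character (`5.4`, `8.5`, `12.11`,
`13.12`, … in EXTREMALS/GRH) with no new transcendental entry.  With the sector split and the dictionary:
`weilPositivityOnChar_of_twistedGramCoeff_sector_psd` — PSD of the even- and odd-sector real Gram matrices of
`twistedGramCoeff χ a` for every `N` ⟹ `WeilPositivityOnChar χ a` (`q ≠ 1`, `a > 0`).

One definition (`twistedGramCoeff`, docstring'd); no named facts; RH/GRH-free.  Odd real characters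
(`a_χ = 1`) need one more kernel (`∫₀^∞ D_t(u) dt/(2cosh(t/2))`, `WeilExplicitArchParitySech.lean`) and are not
treated here.
-/

set_option autoImplicit false

noncomputable section

open Complex Filter Set MeasureTheory
open scoped Real Topology ComplexConjugate ArithmeticFunction.vonMangoldt

namespace Summit.Ventures.WeilGRH

open Literature.NumberTheory.LFunctions
open Literature.NumberTheory.LFunctions.Yoshida1992 (modes chi freq gramCoeff polarCoeff incrCoeff)
open Summit.RiemannHypothesis.RiemannHypothesis.Theorems.WeilFormatC

variable {q : ℕ} {a S : ℝ} {u : ℝ → ℂ}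

/-! ## The twisted Yoshida coefficient of an even real character -/

/-- **The Gram coefficient of an even real character** on Yoshida's basis `χ_n` of `K(a)`:
`G^χ(n,m) = gramCoeff a n m − polarCoeff a n m + Σ_{log k<2a} (χ(k) − 1)Λ(k)k^{-1/2}(incrCoeff a (log k) n m − 2δ_{nm}) + (log q)δ_{nm}`
(Yoshida's (5.15)/(5.16) without the pole term, the jumps at `χ(k) = −1` flipped and at `χ(k) = 0` removed,
the conductor on the diagonal).  It IS the matrix of the twisted window form for `conj χ = χ`, `a_χ = 0`
(`twistedWindowForm_sum_smul_chi_eq_twistedGramCoeff`). -/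
def twistedGramCoeff (χ : DirichletCharacter ℂ q) (a : ℝ) (n m : ℤ) : ℝ :=
  gramCoeff a n m - polarCoeff a n m +
    (∑ k ∈ weilPrimeIndex a, ((χ (k : ZMod q)).re - 1) * ((Λ k : ℝ) / Real.sqrt k) *
      (incrCoeff a (Real.log k) n m - if n = m then 2 else 0)) +
    if n = m then Real.log q else 0

/-- Reflection symmetry `G^χ(−n,−m) = G^χ(n,m)` (from `gramCoeff_neg_neg`, `polarCoeff_neg_neg`,
`incrCoeff_neg_neg`). -/
theorem twistedGramCoeff_neg_neg (χ : DirichletCharacter ℂ q) (a : ℝ) (n m : ℤ) :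
    twistedGramCoeff χ a (-n) (-m) = twistedGramCoeff χ a n m := by
  unfold twistedGramCoeff
  rw [gramCoeff_neg_neg, polarCoeff_neg_neg]
  simp_rw [incrCoeff_neg_neg, neg_inj]

/-- Symmetry `G^χ(n,m) = G^χ(m,n)` (from `gramCoeff_comm`, `polarCoeff_comm`, `incrCoeff_comm`). -/
theorem twistedGramCoeff_comm (χ : DirichletCharacter ℂ q) (a : ℝ) (n m : ℤ) :
    twistedGramCoeff χ a n m = twistedGramCoeff χ a m n := by
  unfold twistedGramCoeff
  rw [Yoshida1992.gramCoeff_comm, Yoshida1992.polarCoeff_comm]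
  simp_rw [Yoshida1992.incrCoeff_comm a _ n m, eq_comm (a := n) (b := m)]

/-! ## Real characters -/

/-- A quadratic character (values in `{0, 1, −1}`, e.g. a Kronecker symbol — the 13 real primitive
characters of conductor `≤ 20`, CHARACTERS.md §3) takes conjugation-invariant values: the hypothesis
`conj χ(n) = χ(n)` of this file and of `TwistedWindowSectors.lean`. -/
theorem conj_apply_eq_self_of_isQuadratic {χ : DirichletCharacter ℂ q} (h : MulChar.IsQuadratic χ)
    (x : ZMod q) : conj (χ x) = χ x := by
  rcases h x with h0 | h1 | h2
  · rw [h0, map_zero]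
  · rw [h1, map_one]
  · rw [h2, map_neg, map_one]

/-! ## The window-level identity for an even real character -/

/-- A real character takes real values: `conj χ(n) = χ(n)` gives `conj χ(n) = ((χ n).re : ℂ)`. -/
private theorem conj_eq_ofReal_re' {z : ℂ} (h : conj z = z) : conj z = ((z.re : ℝ) : ℂ) := by
  rw [h]; exact (Complex.conj_eq_iff_re.1 h).symm

/-- For a real value, `‖z‖² = (Re z)²`. -/
private theorem norm_sq_eq_re_sq {z : ℂ} (h : conj z = z) : ‖z‖ ^ 2 = z.re ^ 2 := by
  rw [← Complex.conj_eq_iff_re.1 h, Complex.norm_real, Real.norm_eq_abs, sq_abs, Complex.ofReal_re]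

/-- The parity-`0` densities are the `ζ` ones. -/
private theorem weilArchDensityPar_zero' : weilArchDensityPar 0 = weilArchDensity := by
  funext t
  simp only [weilArchDensityPar, weilArchDensity, Nat.cast_zero, sub_zero, one_div_mul_eq_div]

/-- The parity-`0` killing density is the `ζ` one. -/
private theorem weilKillingDensityPar_zero' (t : ℝ) :
    weilKillingDensityPar 0 t = (Real.exp (t / 2) - 1) / (2 * Real.sinh t) := by
  simp only [weilKillingDensityPar, Nat.cast_zero, sub_zero, one_div_mul_eq_div]

/-- **The twisted window form of an EVEN REAL character through the `ζ` window form**: for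
`conj χ = χ`, `a_χ = 0` and a bounded measurable `u` vanishing off `[-a, a]`,
`𝓔^χ_a(u) − M^χ_a‖u‖₂² = weilWindowForm a u − P(u) + Σ_{log k<2a} (χ(k) − 1)Λ(k)k^{-1/2}(D_{log k}(u) − 2‖u‖₂²) + (log q)‖u‖₂²`. -/
theorem twistedWindowForm_eq_of_even_real (χ : DirichletCharacter ℂ q)
    (hχ : ∀ n : ℕ, conj (χ (n : ZMod q)) = χ (n : ZMod q)) (heven : charParity χ = 0)
    (hm : Measurable u) (hz : ∀ x, x ∉ Icc (-a) a → u x = 0) (hb : ∀ x, ‖u x‖ ≤ S) :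
    weilDirichletEnergyChar χ a u - weilMarkovConstantChar χ a * ∫ x, ‖u x‖ ^ 2 =
      weilWindowForm a u - weilPoleForm u +
        (∑ k ∈ weilPrimeIndex a, ((χ (k : ZMod q)).re - 1) * ((Λ k : ℝ) / Real.sqrt k) *
          (weilIncrement u (Real.log k) - 2 * ∫ x, ‖u x‖ ^ 2)) +
        Real.log q * ∫ x, ‖u x‖ ^ 2 := by
  have htw : ∀ k : ℕ, weilTwistIncrement (conj (χ (k : ZMod q))) u (Real.log k) =
      (χ (k : ZMod q)).re * weilIncrement u (Real.log k) +
        (1 - (χ (k : ZMod q)).re) ^ 2 * ∫ x, ‖u x‖ ^ 2 := fun k ↦ by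
    rw [conj_eq_ofReal_re' (hχ k), weilTwistIncrement_ofReal hm hz hb]
  have hns : ∀ k : ℕ, ‖χ (k : ZMod q)‖ ^ 2 = (χ (k : ZMod q)).re ^ 2 := fun k ↦ norm_sq_eq_re_sq (hχ k)
  unfold weilDirichletEnergyChar weilMarkovConstantChar weilWindowForm weilDirichletEnergy weilMarkovConstant
  rw [heven, weilArchDensityPar_zero']
  simp_rw [htw, hns, weilKillingDensityPar_zero']
  -- everything is now a polynomial identity in the finitely many sums and the two integrals
  set N2 : ℝ := ∫ x, ‖u x‖ ^ 2
  set A : ℝ := ∫ t in Ioi (0 : ℝ), weilArchDensity t * weilIncrement u t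
  set Kl : ℝ := ∫ t in Ioi (0 : ℝ), (Real.exp (t / 2) - 1) / (2 * Real.sinh t)
  have h1 : ∑ k ∈ weilPrimeIndex a, (Λ k : ℝ) / Real.sqrt k *
      ((χ (k : ZMod q)).re * weilIncrement u (Real.log k) + (1 - (χ (k : ZMod q)).re) ^ 2 * N2) =
      (∑ k ∈ weilPrimeIndex a, (Λ k : ℝ) / Real.sqrt k * weilIncrement u (Real.log k)) +
        ∑ k ∈ weilPrimeIndex a, ((χ (k : ZMod q)).re - 1) * ((Λ k : ℝ) / Real.sqrt k) *
          (weilIncrement u (Real.log k) - 2 * N2) +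
        N2 * ∑ k ∈ weilPrimeIndex a, (Λ k : ℝ) / Real.sqrt k * (1 + (χ (k : ZMod q)).re ^ 2) -
        2 * N2 * ∑ k ∈ weilPrimeIndex a, (Λ k : ℝ) / Real.sqrt k := by
    rw [Finset.mul_sum, Finset.mul_sum, ← Finset.sum_add_distrib, ← Finset.sum_add_distrib,
      ← Finset.sum_sub_distrib]
    exact Finset.sum_congr rfl fun k _ ↦ by ring
  rw [h1]
  ring

/-! ## The entry theorem on the trigonometric windows -/

section Pairing

variable (s : Finset ℤ) (c : ℤ → ℂ)

/-- Linearity of the real pairing `G ↦ Σ_n Σ_m Re(conj c_n c_m) G(n,m)`: sums. -/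
private theorem pair_add (G H : ℤ → ℤ → ℝ) :
    ∑ n ∈ s, ∑ m ∈ s, (conj (c n) * c m).re * (G n m + H n m) =
      (∑ n ∈ s, ∑ m ∈ s, (conj (c n) * c m).re * G n m) +
        ∑ n ∈ s, ∑ m ∈ s, (conj (c n) * c m).re * H n m := by
  simp only [mul_add, Finset.sum_add_distrib]

/-- Linearity of the real pairing: differences. -/
private theorem pair_sub (G H : ℤ → ℤ → ℝ) :
    ∑ n ∈ s, ∑ m ∈ s, (conj (c n) * c m).re * (G n m - H n m) =
      (∑ n ∈ s, ∑ m ∈ s, (conj (c n) * c m).re * G n m) -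
        ∑ n ∈ s, ∑ m ∈ s, (conj (c n) * c m).re * H n m := by
  simp only [mul_sub, Finset.sum_sub_distrib]

/-- Linearity of the real pairing: scalars. -/
private theorem pair_const_mul (r : ℝ) (G : ℤ → ℤ → ℝ) :
    ∑ n ∈ s, ∑ m ∈ s, (conj (c n) * c m).re * (r * G n m) =
      r * ∑ n ∈ s, ∑ m ∈ s, (conj (c n) * c m).re * G n m := by
  rw [Finset.mul_sum]
  refine Finset.sum_congr rfl fun n _ ↦ ?_
  rw [Finset.mul_sum]
  exact Finset.sum_congr rfl fun m _ ↦ by ring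

/-- Linearity of the real pairing: finite sums of kernels. -/
private theorem pair_sum (t : Finset ℕ) (G : ℕ → ℤ → ℤ → ℝ) :
    ∑ n ∈ s, ∑ m ∈ s, (conj (c n) * c m).re * (∑ k ∈ t, G k n m) =
      ∑ k ∈ t, ∑ n ∈ s, ∑ m ∈ s, (conj (c n) * c m).re * G k n m := by
  calc ∑ n ∈ s, ∑ m ∈ s, (conj (c n) * c m).re * ∑ k ∈ t, G k n m
      = ∑ n ∈ s, ∑ m ∈ s, ∑ k ∈ t, (conj (c n) * c m).re * G k n m := by
        simp only [Finset.mul_sum]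
    _ = ∑ n ∈ s, ∑ k ∈ t, ∑ m ∈ s, (conj (c n) * c m).re * G k n m :=
        Finset.sum_congr rfl fun n _ ↦ Finset.sum_comm
    _ = ∑ k ∈ t, ∑ n ∈ s, ∑ m ∈ s, (conj (c n) * c m).re * G k n m := Finset.sum_comm

end Pairing

/-- **ENTRY THEOREM for an even real character**: for `conj χ = χ`, `a_χ = 0`, `a > 0`, every finite set
of modes `s` and coefficients `c`,
`𝓔^χ_a(Σ c_nχ_n) − M^χ_a‖Σ c_nχ_n‖₂² = Σ_n Σ_m Re(conj c_n c_m) · twistedGramCoeff χ a n m`. -/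
theorem twistedWindowForm_sum_smul_chi_eq_twistedGramCoeff (χ : DirichletCharacter ℂ q)
    (hχ : ∀ n : ℕ, conj (χ (n : ZMod q)) = χ (n : ZMod q)) (heven : charParity χ = 0) (ha : 0 < a)
    (s : Finset ℤ) (c : ℤ → ℂ) :
    weilDirichletEnergyChar χ a (∑ n ∈ s, c n • chi a n) -
        weilMarkovConstantChar χ a * ∫ x, ‖(∑ n ∈ s, c n • chi a n) x‖ ^ 2 =
      ∑ n ∈ s, ∑ m ∈ s, (conj (c n) * c m).re * twistedGramCoeff χ a n m := by
  rw [twistedWindowForm_eq_of_even_real χ hχ heven (measurable_sum_smul_chi _ _)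
    (fun x hx ↦ sum_smul_chi_eq_zero _ _ hx) (fun x ↦ norm_sum_smul_chi_le _ _ x),
    weilWindowForm_sum_smul_chi_eq_gramCoeff ha, weilPoleForm_sum_smul_chi ha,
    integral_norm_sq_sum_smul_chi' ha]
  -- the increments at the prime lengths, as pairings with `incrCoeff`
  have hK : ∀ k ∈ weilPrimeIndex a, weilIncrement (∑ n ∈ s, c n • chi a n) (Real.log k) =
      ∑ n ∈ s, ∑ m ∈ s, (conj (c n) * c m).re * incrCoeff a (Real.log k) n m := by
    intro k hk
    rw [weilIncrement_sum_smul_chi ha s c (Real.log_natCast_nonneg k) (mem_weilPrimeIndex.1 hk).le]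
    rfl
  have hP : (∑ n ∈ s, ∑ m ∈ s, (conj (c n) * c m).re *
      ((-1 : ℝ) ^ (n + m) * (4 / a) * (Real.exp (a / 2) - Real.exp (-(a / 2))) ^ 2 *
        (1 - 4 * (π * n / a) * (π * m / a)) / ((1 + 4 * (π * n / a) ^ 2) * (1 + 4 * (π * m / a) ^ 2)))) =
      ∑ n ∈ s, ∑ m ∈ s, (conj (c n) * c m).re * polarCoeff a n m := rfl
  have hKsum : (∑ k ∈ weilPrimeIndex a, ((χ (k : ZMod q)).re - 1) * ((Λ k : ℝ) / Real.sqrt k) *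
      (weilIncrement (∑ n ∈ s, c n • chi a n) (Real.log k) -
        2 * ∑ n ∈ s, ∑ m ∈ s, (conj (c n) * c m).re * (if n = m then (1 : ℝ) else 0))) =
      ∑ n ∈ s, ∑ m ∈ s, (conj (c n) * c m).re *
        ∑ k ∈ weilPrimeIndex a, ((χ (k : ZMod q)).re - 1) * ((Λ k : ℝ) / Real.sqrt k) *
          (incrCoeff a (Real.log k) n m - if n = m then 2 else 0) := by
    rw [pair_sum]
    refine Finset.sum_congr rfl fun k hk ↦ ?_
    rw [hK k hk, ← pair_const_mul s c (2 : ℝ), ← pair_sub, ← pair_const_mul]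
    refine Finset.sum_congr rfl fun n _ ↦ Finset.sum_congr rfl fun m _ ↦ ?_
    split_ifs <;> ring
  have hQ : Real.log q * (∑ n ∈ s, ∑ m ∈ s, (conj (c n) * c m).re * (if n = m then (1 : ℝ) else 0)) =
      ∑ n ∈ s, ∑ m ∈ s, (conj (c n) * c m).re * (if n = m then Real.log q else 0) := by
    rw [← pair_const_mul]
    refine Finset.sum_congr rfl fun n _ ↦ Finset.sum_congr rfl fun m _ ↦ ?_
    split_ifs <;> ring
  rw [hP, hKsum, hQ, ← pair_sub, ← pair_add, ← pair_add]
  rfl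

/-! ## The certificate interface for an even real character -/

/-- **A REAL SECTOR PSD CERTIFICATE of `twistedGramCoeff χ a` gives the rung** (`q ≠ 1`, `a > 0`,
`conj χ = χ`, `a_χ = 0`): if for every `N` the even-sector matrix
(`n = 0`: `G^χ(0,m)`; `m = 0`: `G^χ(n,0)`; else `(G^χ(n,m) + G^χ(n,−m))/2` on `range (N+1)`) and the odd-sector
matrix (`(G^χ(k+1,l+1) − G^χ(k+1,−(l+1)))/2` on `range N`) are positive semidefinite as real quadratic forms,
then `WeilPositivityOnChar χ a` — the shape of `weilPositivityOn_of_gramCoeff_sector_psd` (weil-2), priced by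
the same format-C/E evaluators. -/
theorem weilPositivityOnChar_of_twistedGramCoeff_sector_psd (hq : q ≠ 1) (χ : DirichletCharacter ℂ q)
    (hχ : ∀ n : ℕ, conj (χ (n : ZMod q)) = χ (n : ZMod q)) (heven : charParity χ = 0) (ha : 0 < a)
    (hev : ∀ (N : ℕ) (y : ℕ → ℝ), 0 ≤ ∑ n ∈ Finset.range (N + 1), ∑ m ∈ Finset.range (N + 1),
      y n * y m * (if n = 0 then twistedGramCoeff χ a 0 m else if m = 0 then twistedGramCoeff χ a n 0
        else (twistedGramCoeff χ a n m + twistedGramCoeff χ a n (-(m : ℤ))) / 2))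
    (hod : ∀ (N : ℕ) (z : ℕ → ℝ), 0 ≤ ∑ k ∈ Finset.range N, ∑ l ∈ Finset.range N,
      z k * z l * ((twistedGramCoeff χ a ((k : ℤ) + 1) ((l : ℤ) + 1) -
        twistedGramCoeff χ a ((k : ℤ) + 1) (-((l : ℤ) + 1))) / 2)) :
    WeilPositivityOnChar χ a :=
  weilPositivityOnChar_of_twistedWindowForm_sum_chi_nonneg hq χ ha fun N c ↦ by
    rw [twistedWindowForm_sum_smul_chi_eq_twistedGramCoeff χ hχ heven ha]
    exact sum_modes_re_conj_mul_nonneg_of_sectors (twistedGramCoeff χ a) (twistedGramCoeff_neg_neg χ a)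
      N (hev N) (hod N) c

/-- The unsplit form: PSD of `(twistedGramCoeff χ a n m)_{|n|,|m| ≤ N}` as a hermitian form for every `N`
gives the rung. -/
theorem weilPositivityOnChar_of_twistedGramCoeff_psd (hq : q ≠ 1) (χ : DirichletCharacter ℂ q)
    (hχ : ∀ n : ℕ, conj (χ (n : ZMod q)) = χ (n : ZMod q)) (heven : charParity χ = 0) (ha : 0 < a)
    (hpsd : ∀ (N : ℕ) (c : ℤ → ℂ),
      0 ≤ ∑ n ∈ modes N, ∑ m ∈ modes N, (conj (c n) * c m).re * twistedGramCoeff χ a n m) :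
    WeilPositivityOnChar χ a :=
  weilPositivityOnChar_of_twistedWindowForm_sum_chi_nonneg hq χ ha fun N c ↦ by
    rw [twistedWindowForm_sum_smul_chi_eq_twistedGramCoeff χ hχ heven ha]
    exact hpsd N c

/-! ## The end-to-end statement: format-C data for an even real character ⟹ the rung -/

open Finset Matrix in
/-- **FORMAT C for an even real character ⟹ `WeilPositivityOnChar χ a`** — the `χ`-twisted twin of weil-10's
`weilPositivityOn_of_formatC_certificates`, with the Gram kernel `G = twistedGramCoeff χ a` supplied by this
file's entry theorem (no `hG` hypothesis).  Per sector: a block size `B`, a far diagonal `d̂ > 0` on `m ≥ B`,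
a real `B × B` majorant `U`, the two analytic hypotheses on every truncation `Ico B N` (far bound, coupling
majorant) and the kernel-decided certificate `∀ x, 0 ≤ Σ_{i,j<B} x_i x_j (M(i,j) − U_{ij})`; conclusion:
`WeilPositivityOnChar χ a` (`q ≠ 1`, `a > 0`, `conj χ = χ`, `a_χ = 0`). -/
theorem weilPositivityOnChar_of_formatC_certificates (hq : q ≠ 1) (χ : DirichletCharacter ℂ q)
    (hχ : ∀ n : ℕ, conj (χ (n : ZMod q)) = χ (n : ZMod q)) (heven : charParity χ = 0) (ha : 0 < a)
    -- even sector
    (Be : ℕ) (de : ℕ → ℝ) (Ue : Matrix (Fin Be) (Fin Be) ℝ) (hde : ∀ m, Be ≤ m → 0 < de m)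
    (hfar_e : ∀ (N : ℕ) (y : ℕ → ℝ),
      ∑ n ∈ Ico Be N, de n * y n ^ 2 ≤ ∑ n ∈ Ico Be N, ∑ m ∈ Ico Be N,
        y n * (if n = 0 then twistedGramCoeff χ a 0 m else if m = 0 then twistedGramCoeff χ a n 0
          else (twistedGramCoeff χ a n m + twistedGramCoeff χ a n (-(m : ℤ))) / 2) * y m)
    (hU_e : ∀ (N : ℕ) (x : Fin Be → ℝ),
      ∑ m ∈ Ico Be N, (∑ i : Fin Be,
        (if (i : ℕ) = 0 then twistedGramCoeff χ a 0 m else if m = 0 then twistedGramCoeff χ a i 0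
          else (twistedGramCoeff χ a i m + twistedGramCoeff χ a i (-(m : ℤ))) / 2) * x i) ^ 2 / de m ≤
        x ⬝ᵥ Ue *ᵥ x)
    (hS_e : ∀ x : Fin Be → ℝ, 0 ≤ ∑ i, ∑ j, x i * x j *
      ((if (i : ℕ) = 0 then twistedGramCoeff χ a 0 j else if (j : ℕ) = 0 then twistedGramCoeff χ a i 0
        else (twistedGramCoeff χ a i j + twistedGramCoeff χ a i (-(j : ℤ))) / 2) - Ue i j))
    -- odd sector
    (Bo : ℕ) (dod : ℕ → ℝ) (Uo : Matrix (Fin Bo) (Fin Bo) ℝ) (hdo : ∀ m, Bo ≤ m → 0 < dod m)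
    (hfar_o : ∀ (N : ℕ) (z : ℕ → ℝ),
      ∑ k ∈ Ico Bo N, dod k * z k ^ 2 ≤ ∑ k ∈ Ico Bo N, ∑ l ∈ Ico Bo N,
        z k * ((twistedGramCoeff χ a ((k : ℤ) + 1) ((l : ℤ) + 1) -
          twistedGramCoeff χ a ((k : ℤ) + 1) (-((l : ℤ) + 1))) / 2) * z l)
    (hU_o : ∀ (N : ℕ) (x : Fin Bo → ℝ),
      ∑ l ∈ Ico Bo N, (∑ i : Fin Bo,
        ((twistedGramCoeff χ a ((i : ℤ) + 1) ((l : ℤ) + 1) -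
          twistedGramCoeff χ a ((i : ℤ) + 1) (-((l : ℤ) + 1))) / 2) * x i) ^ 2 / dod l ≤ x ⬝ᵥ Uo *ᵥ x)
    (hS_o : ∀ x : Fin Bo → ℝ, 0 ≤ ∑ i, ∑ j, x i * x j *
      ((twistedGramCoeff χ a ((i : ℤ) + 1) ((j : ℤ) + 1) -
        twistedGramCoeff χ a ((i : ℤ) + 1) (-((j : ℤ) + 1))) / 2 - Uo i j)) :
    WeilPositivityOnChar χ a := by
  have hsymm := twistedGramCoeff_comm χ a
  have hrefl := twistedGramCoeff_neg_neg χ a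
  refine weilPositivityOnChar_of_twistedGramCoeff_sector_psd hq χ hχ heven ha (fun N y ↦ ?_) (fun N z ↦ ?_)
  · exact sum_range_mul_mul_nonneg_of_certificate_sum
      (fun n m : ℕ ↦ if n = 0 then twistedGramCoeff χ a 0 m else if m = 0 then twistedGramCoeff χ a n 0
        else (twistedGramCoeff χ a n m + twistedGramCoeff χ a n (-(m : ℤ))) / 2)
      (fun n m ↦ evenKernel_symm _ hsymm hrefl n m) Be de Ue hde hfar_e hU_e hS_e (N + 1) y
  · exact sum_range_mul_mul_nonneg_of_certificate_sum
      (fun k l : ℕ ↦ (twistedGramCoeff χ a ((k : ℤ) + 1) ((l : ℤ) + 1) -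
        twistedGramCoeff χ a ((k : ℤ) + 1) (-((l : ℤ) + 1))) / 2)
      (fun k l ↦ oddKernel_symm _ hsymm hrefl k l) Bo dod Uo hdo hfar_o hU_o hS_o N z

end Summit.Ventures.WeilGRH

end
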